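import Summits.BirchSwinnertonDyer.Rank1Residual.X5.SelmerSolitaireQuadratic
import Summits.BirchSwinnertonDyer.Rank1Residual.X5.SelmerSolitaireAlternating
import Summits.BirchSwinnertonDyer.Rank1Residual.X5.SelmerSolitairePivotAux
import HarnessLib

/-!
# Selmer solitaire, QUADRATIC-SPACE LAYER (ii‴) — Q2: the CORE TEST `coreTest_holds : CoreTest` (QS1c)

Cell `b2b-bsdres`, O1 programme (p = 2), ORDER v2.9 pool slot (ii‴) (o1 lead GEN 20, R-G20.3/R-G20.4,
PLAN C150/C153), file Q2 of Q1 → Q2 → Q4 → Q5; pool hand x11b3-p4 GEN 5. THEOREMS ONLY (no definition,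
no named fact, no `sorry`); imports Q1 (`X5.SelmerSolitaireQuadratic`, the vocabulary — p283641),
p2's `X5.SelmerSolitaireAlternating` (alternating matrices over `𝔽₂`) and `X5.SelmerSolitairePivotAux`
(`det_submatrix_eq_zero_iff`, singular principal minors read on the ambient index type).

HONEST FRAMING (cell, verbatim): research route; pure `𝔽₂` linear algebra — no curve, no Galois group,
no prime; nothing arithmetic asserted (the dictionary AR1–AR4 is NOT here); reach-neutral (R1 closes
no class); nothing booked; no mark / label / count moved; O1 OPEN.

## What is proved (lens-2 GEN 10, 2G10.2 QS1c = GEN 5 T3 (i); reserved name `coreTest_holds`, 2G10.10)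
`CoreTest : ∀ s (P : Position s) (b : Bool), IsTSLagrangian (nfSpace P b) ∧ ∀ n, CoreQ (nfSpace P b) n ↔ Core P n`.
§1 the T3 parametrisation `(ε, z) ↦ nfVec P b ε z` is linear and injective, so `nfSpace P b` is the
set of T3 vectors (`mem_nfSpace_iff`) of dimension `s + 1` (`finrank_nfSpace`); §2 LAGRANGIAN HALF
`q(nfVec P b ε z) = zᵀ Ŝ_D z + 2 ε (σ·z) = 0` (`qform_nfVec` ⇐ `Alt.dotProduct_mulVec_self_eq_zero`),
`isTSLagrangian_nfSpace`; §3 DICTIONARY to ambient vectors `y = (ε; z) : V s → 𝔽₂`: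
`nfVec P b ε z ∈ Λ*_n` iff `y` is supported on `X = n` (old vertices) and `Ŝ y` vanishes on
`X ∪ {∞}` (`inLamStar_nfVec_iff`, `coreQ_nfSpace_iff`); §4 CORE TEST: that criterion is `Core P n`
(`det Ŝ[n⁺] = 1`, `n⁺ = n` for `|n|` even, `n ∪ {∞}` for `|n|` odd; `forall_killed_iff_core`):
`Core P n` is the trivial-kernel statement on `n⁺` (`core_iff_forall` ⇐ `det_submatrix_eq_zero_iff`),
and the `∞`-row gap is closed by (a) an alternating matrix on an ODD vertex set is singular
(`exists_killed_of_card_odd` ⇐ `Alt.det_submatrix_eq_zero_of_card_odd`, applied to `n ∪ {∞}` resp.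
`n`) and (b) the SYMMETRIC TRICK `0 = x·(Ŝ w) = w·(Ŝ x) = w(∞)·(Ŝ x)(∞)`
(`mulVec_none_eq_zero_of_witness`). END: `coreQ_nfSpace_iff_core`, **`coreTest_holds : CoreTest`**.
Executable evidence (lens-2 GEN 10, EVIDENCE only): `code/qs_layer_check.py`, 1 024 / 1 024 core tests
at `|D| = 3` agree with `det Ŝ[n⁺]`.

## References
* lens-2 GEN 5 G5.2 (T3 (i)), GEN 10 2G10.2 / 2G10.6 (`cells/o1/ROUTES-O1.md` l.1966–1988);
  B. Mazur, K. Rubin, *Introduction to Kolyvagin systems*, Contemp. Math. 358 (2004), Def. 4.2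
  [MazurRubin2004Intro]; B. Poonen, E. Rains, JAMS 25 (2012), §4, Thm. 4.13 [PoonenRains2012].

## Tree search (dedup, 2026-08-21)
`lean search 'coreTest_holds|qform_nfVec|inLamStar_nfVec'` → none; tools reused BY NAME from p2's
`SelmerSolitaireAlternating` (`Alt.*`) and `SelmerSolitairePivotAux` (`det_submatrix_eq_zero_iff`).
-/

namespace Summit.BirchSwinnertonDyer.Rank1Residual.X5.SelmerSolitaire.Quadratic

open Finset Matrix SelmerSolitaire

variable {s : ℕ}

/-- `nfVec P b 0 0 = 0`. [folklore] -/
theorem nfVec_zero (P : Position s) (b : Bool) : nfVec P b 0 0 = 0 := by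
  funext v
  cases v with
  | none => apply Prod.ext <;> cases b <;> simp [nfVec, lineOf]
  | some l => apply Prod.ext <;> simp [nfVec]

/-- `nfVec` is additive in `(ε, z)`. [folklore] -/
theorem nfVec_add (P : Position s) (b : Bool) (ε ε' : ZMod 2) (z z' : Fin s → ZMod 2) :
    nfVec P b ε z + nfVec P b ε' z' = nfVec P b (ε + ε') (z + z') := by
  funext v
  cases v with
  | none => apply Prod.ext <;> cases b <;> simp [nfVec, lineOf, mul_add, sum_add_distrib]
  | some l =>
    apply Prod.ext
    · simp [nfVec, mul_add, sum_add_distrib, add_mul]; abel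
    · simp [nfVec]

/-- The `t`-coordinates of `nfVec P b ε z` are `z`. [folklore] -/
theorem nfVec_some_snd (P : Position s) (b : Bool) (ε : ZMod 2) (z : Fin s → ZMod 2)
    (l : Fin s) : (nfVec P b ε z (some l)).2 = z l := rfl

/-- The `u`-coordinates of `nfVec P b ε z` are `(S z + ε σ)`. [folklore] -/
theorem nfVec_some_fst (P : Position s) (b : Bool) (ε : ZMod 2) (z : Fin s → ZMod 2) (l : Fin s) :
    (nfVec P b ε z (some l)).1 = (∑ l', P.S (some l) (some l') * z l') + ε * P.S (some l) none := rfl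

/-- The `λ`-coordinate of `nfVec P b ε z` at `∞` is `ε`. [folklore] -/
theorem lamCoord_nfVec_none (P : Position s) (b : Bool) (ε : ZMod 2) (z : Fin s → ZMod 2) :
    lamCoord b (nfVec P b ε z none) = ε := by
  cases b <;> simp [nfVec, lamCoord, lineOf]

/-- The `λ′`-coordinate of `nfVec P b ε z` at `∞` is `σ · z`. [folklore] -/
theorem lamCoord_not_nfVec_none (P : Position s) (b : Bool) (ε : ZMod 2) (z : Fin s → ZMod 2) :
    lamCoord (!b) (nfVec P b ε z none) = ∑ l, P.S (some l) none * z l := by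
  cases b <;> simp [nfVec, lamCoord, lineOf]

/-- `nfVec` is homogeneous in `(ε, z)` (scalars `𝔽₂`). [folklore] -/
theorem nfVec_smul (P : Position s) (b : Bool) (c ε : ZMod 2) (z : Fin s → ZMod 2) :
    c • nfVec P b ε z = nfVec P b (c * ε) (c • z) := by
  rcases (by decide : ∀ c : ZMod 2, c = 0 ∨ c = 1) c with rfl | rfl
  · rw [zero_smul, zero_mul, zero_smul, nfVec_zero]
  · rw [one_smul, one_mul, one_smul]

/-- Membership in `nfSpace`: exactly the vectors `nfVec P b ε z`. [folklore] -/
theorem mem_nfSpace_iff (P : Position s) (b : Bool) (x : QVec s) :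
    x ∈ nfSpace P b ↔ ∃ ε z, x = nfVec P b ε z := by
  constructor
  · intro hx
    induction hx using Submodule.span_induction with
    | mem x hx => exact hx
    | zero => exact ⟨0, 0, (nfVec_zero P b).symm⟩
    | add x y _ _ hx hy =>
      obtain ⟨ε, z, rfl⟩ := hx
      obtain ⟨ε', z', rfl⟩ := hy
      exact ⟨ε + ε', z + z', nfVec_add P b ε ε' z z'⟩
    | smul c x _ hx =>
      obtain ⟨ε, z, rfl⟩ := hx
      exact ⟨c * ε, c • z, nfVec_smul P b c ε z⟩
  · rintro ⟨ε, z, rfl⟩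
    exact Submodule.subset_span ⟨ε, z, rfl⟩

/-- The product of the two `∞`-coordinates of `nfVec P b ε z` is `ε · (σ · z)` (either type bit). [folklore] -/
theorem nfVec_none_fst_mul_snd (P : Position s) (b : Bool) (ε : ZMod 2) (z : Fin s → ZMod 2) :
    (nfVec P b ε z none).1 * (nfVec P b ε z none).2 = ε * ∑ l, P.S (some l) none * z l := by
  cases b <;> simp [nfVec, lineOf, mul_comm]

/-- **T3 vectors are `Q`-singular**: `q(nfVec P b ε z) = zᵀ S_D z + 2 ε (σ·z) = 0`. [folklore] -/
theorem qform_nfVec (P : Position s) (b : Bool) (ε : ZMod 2) (z : Fin s → ZMod 2) :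
    qform (nfVec P b ε z) = 0 := by
  unfold qform
  rw [Fintype.sum_option, nfVec_none_fst_mul_snd]
  simp only [nfVec_some_fst, nfVec_some_snd, add_mul, sum_add_distrib]
  -- `Σ_l (S z)_l z_l = 0` (alternating) and the two `ε (σ·z)` terms cancel in characteristic 2
  have halt : ∑ l, (∑ l', P.S (some l) (some l') * z l') * z l = 0 := by
    have h := Alt.dotProduct_mulVec_self_eq_zero (P.S.submatrix some some) (P.symm.submatrix some)
      (fun i => P.loopless (some i)) z
    simpa [dotProduct, Matrix.mulVec, mul_comm] using h
  rw [halt, zero_add]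
  have h2 : ∑ l, ε * P.S (some l) none * z l = ε * ∑ l, P.S (some l) none * z l := by
    rw [mul_sum]; simp_rw [mul_assoc]
  rw [h2, CharTwo.add_self_eq_zero]

/-- `nfVec` is injective in `(ε, z)`: `z` is read off the `t`-coordinates and `ε` off the
`λ`-coordinate at `∞`. [folklore] -/
theorem nfVec_injective (P : Position s) (b : Bool) {ε ε' : ZMod 2} {z z' : Fin s → ZMod 2}
    (h : nfVec P b ε z = nfVec P b ε' z') : ε = ε' ∧ z = z' := by
  refine ⟨?_, funext fun l => ?_⟩
  · have := congrArg (fun x => lamCoord b (x none)) h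
    simpa only [lamCoord_nfVec_none] using this
  · have := congrArg (fun x => (x (some l)).2) h
    simpa only [nfVec_some_snd] using this

/-- **`dim 𝒰(P, b) = s + 1`.** [folklore] -/
theorem finrank_nfSpace (P : Position s) (b : Bool) :
    Module.finrank (ZMod 2) (nfSpace P b) = s + 1 := by
  -- the parametrisation as a linear map from `ZMod 2 × (Fin s → ZMod 2)`
  let Φ : (ZMod 2 × (Fin s → ZMod 2)) →ₗ[ZMod 2] QVec s :=
    { toFun := fun p => nfVec P b p.1 p.2
      map_add' := fun p p' => (nfVec_add P b p.1 p'.1 p.2 p'.2).symm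
      map_smul' := fun c p => (nfVec_smul P b c p.1 p.2).symm }
  have hrange : LinearMap.range Φ = nfSpace P b := by
    ext x
    rw [LinearMap.mem_range, mem_nfSpace_iff]
    exact ⟨fun ⟨p, hp⟩ => ⟨p.1, p.2, hp.symm⟩, fun ⟨ε, z, h⟩ => ⟨(ε, z), h.symm⟩⟩
  have hinj : Function.Injective Φ := fun p p' h =>
    Prod.ext (nfVec_injective P b h).1 (nfVec_injective P b h).2
  rw [← hrange, LinearMap.finrank_range_of_inj hinj, Module.finrank_prod, Module.finrank_self,
    Module.finrank_fin_fun, add_comm]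

/-- **`𝒰(P, b)` is a totally singular Lagrangian** (first half of QS1c): totally `Q`-singular of dimension
`s + 1 = |D| + 1` (Poonen–Rains: the Selmer image is a maximal isotropic, indeed totally singular,
subspace). [cite: PoonenRains2012, Thm. 4.13] -/
theorem isTSLagrangian_nfSpace (P : Position s) (b : Bool) : IsTSLagrangian (nfSpace P b) := by
  refine ⟨fun x hx => ?_, finrank_nfSpace P b⟩
  obtain ⟨ε, z, rfl⟩ := (mem_nfSpace_iff P b x).mp hx
  exact qform_nfVec P b ε z

/-! ### Core test: dictionary to ambient vectors `y : V s → 𝔽₂` -/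


/-- `lamCoord b 0 = 0`. [folklore] -/
@[simp] theorem lamCoord_zero (b : Bool) : lamCoord b (0 : ZMod 2 × ZMod 2) = 0 := by
  cases b <;> rfl

/-- The ambient coordinate vector of the T3 parameters, `y(∞) = ε`, `y(ℓ) = z_ℓ`, times `S`, read
at an old vertex: the `u`-coordinate of `nfVec`. [folklore] -/
theorem mulVec_elim_some (P : Position s) (ε : ZMod 2) (z : Fin s → ZMod 2) (l : Fin s) :
    (P.S *ᵥ fun v => Option.elim v ε z) (some l) =
      (∑ l', P.S (some l) (some l') * z l') + ε * P.S (some l) none := by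
  simp only [Matrix.mulVec, dotProduct, Fintype.sum_option, Option.elim]
  rw [add_comm, mul_comm]

/-- At `∞`: `(S y)(∞) = σ · z` (the diagonal entry `S ∞ ∞` vanishes). [folklore] -/
theorem mulVec_elim_none (P : Position s) (ε : ZMod 2) (z : Fin s → ZMod 2) :
    (P.S *ᵥ fun v => Option.elim v ε z) none = ∑ l, P.S (some l) none * z l := by
  simp only [Matrix.mulVec, dotProduct, Fintype.sum_option, Option.elim, P.loopless, zero_mul,
    zero_add]
  exact Finset.sum_congr rfl fun l _ => by rw [P.symm.apply (some l) none]

/-- The `∞`-part of `nfVec P b ε z` vanishes iff `ε = 0` and `σ · z = 0`. [folklore] -/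
theorem nfVec_none_eq_zero_iff (P : Position s) (b : Bool) (ε : ZMod 2) (z : Fin s → ZMod 2) :
    nfVec P b ε z none = 0 ↔ ε = 0 ∧ ∑ l, P.S (some l) none * z l = 0 := by
  constructor
  · intro h
    exact ⟨by simpa only [lamCoord_nfVec_none, lamCoord_zero] using congrArg (lamCoord b) h,
      by simpa only [lamCoord_not_nfVec_none, lamCoord_zero] using congrArg (lamCoord (!b)) h⟩
  · rintro ⟨h1, h2⟩
    cases b <;> simp [nfVec, lineOf, h1, h2]

/-- Support of the ambient vector `y = (ε; z)` inside `X = n` (old vertices): `ε = 0` and `z` vanishes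
off `n`. [folklore] -/
theorem support_elim_iff (ε : ZMod 2) (z : Fin s → ZMod 2) (n : Finset (Fin s)) :
    (∀ v : V s, v ∉ n.map Function.Embedding.some → (fun v => Option.elim v ε z) v = 0) ↔
      ε = 0 ∧ ∀ i, i ∉ n → z i = 0 := by
  constructor
  · intro h
    refine ⟨h none (by simp), fun i hi => h (some i) ?_⟩
    simpa using hi
  · rintro ⟨hε, hz⟩ v hv
    cases v with
    | none => exact hε
    | some i => exact hz i (by simpa using hv)

/-- `S y` vanishes on `X ∪ {∞}` iff `σ · z = 0` and the `u`-coordinates of `nfVec` vanish on `n`. [folklore] -/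
theorem killed_elim_iff (P : Position s) (ε : ZMod 2) (z : Fin s → ZMod 2) (n : Finset (Fin s)) :
    (∀ v ∈ insert none (n.map Function.Embedding.some), (P.S *ᵥ fun v => Option.elim v ε z) v = 0) ↔
      (∑ l, P.S (some l) none * z l = 0) ∧
        ∀ i ∈ n, (∑ l', P.S (some i) (some l') * z l') + ε * P.S (some i) none = 0 := by
  simp only [Finset.mem_insert, Finset.mem_map, Function.Embedding.some_apply, forall_eq_or_imp,
    mulVec_elim_none]
  refine and_congr Iff.rfl ⟨fun h i hi => ?_, fun h v hv => ?_⟩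
  · have := h (some i) ⟨i, hi, rfl⟩
    rwa [mulVec_elim_some] at this
  · obtain ⟨i, hi, rfl⟩ := hv
    rw [mulVec_elim_some]
    exact h i hi

/-- **Dictionary**: `nfVec P b ε z ∈ Λ*_n` iff the ambient vector `y = (ε; z)` is supported on
`X = n` (old vertices) and `S y` vanishes on `X ∪ {∞}`. [folklore] -/
theorem inLamStar_nfVec_iff (P : Position s) (b : Bool) (ε : ZMod 2) (z : Fin s → ZMod 2)
    (n : Finset (Fin s)) :
    InLamStar n (nfVec P b ε z) ↔
      (∀ v : V s, v ∉ n.map Function.Embedding.some → (fun v => Option.elim v ε z) v = 0) ∧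
        ∀ v ∈ insert none (n.map Function.Embedding.some),
          (P.S *ᵥ fun v => Option.elim v ε z) v = 0 := by
  rw [support_elim_iff, killed_elim_iff, InLamStar, nfVec_none_eq_zero_iff, InLam]
  simp only [nfVec_some_fst, nfVec_some_snd]
  constructor
  · rintro ⟨⟨hε, hσ⟩, hlam⟩
    exact ⟨⟨hε, fun i hi => (hlam i).2 hi⟩, hσ, fun i hi => (hlam i).1 hi⟩
  · rintro ⟨⟨hε, hoff⟩, hσ, hon⟩
    exact ⟨⟨hε, hσ⟩, fun i => ⟨hon i, hoff i⟩⟩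

/-- Every ambient vector is `(ε; z)` for `ε = y ∞`, `z = y ∘ some`. [folklore] -/
theorem elim_none_some (y : V s → ZMod 2) : (fun v => Option.elim v (y none) (fun l => y (some l))) = y := by
  funext v; cases v <;> rfl

/-- `nfVec P b ε z = 0` iff the ambient vector `(ε; z)` vanishes. [folklore] -/
theorem nfVec_eq_zero_iff (P : Position s) (b : Bool) (ε : ZMod 2) (z : Fin s → ZMod 2) :
    nfVec P b ε z = 0 ↔ (fun v : V s => Option.elim v ε z) = 0 := by
  rw [← nfVec_zero P b]
  refine ⟨fun h => ?_, fun h => ?_⟩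
  · obtain ⟨h1, h2⟩ := nfVec_injective P b h
    funext v; cases v with
    | none => exact h1
    | some l => exact congrFun h2 l
  · rw [show ε = 0 from congrFun h none, show z = 0 from funext fun l => congrFun h (some l)]

/-- **`CoreQ` in ambient coordinates**: `n` is core for `𝒰(P, b)` iff every vector supported on
`X = n` whose image under `S` vanishes on `X ∪ {∞}` is zero. [folklore] -/
theorem coreQ_nfSpace_iff (P : Position s) (b : Bool) (n : Finset (Fin s)) :
    CoreQ (nfSpace P b) n ↔
      ∀ y : V s → ZMod 2, (∀ v, v ∉ n.map Function.Embedding.some → y v = 0) →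
        (∀ v ∈ insert none (n.map Function.Embedding.some), (P.S *ᵥ y) v = 0) → y = 0 := by
  constructor
  · intro h y hsupp hkill
    have hy := elim_none_some y
    have hmem : nfVec P b (y none) (fun l => y (some l)) ∈ nfSpace P b :=
      (mem_nfSpace_iff P b _).mpr ⟨_, _, rfl⟩
    have hlam : InLamStar n (nfVec P b (y none) (fun l => y (some l))) := by
      rw [inLamStar_nfVec_iff, hy]
      exact ⟨hsupp, hkill⟩
    have := h _ hmem hlam
    rwa [nfVec_eq_zero_iff, hy] at this
  · intro h x hx hlam
    obtain ⟨ε, z, rfl⟩ := (mem_nfSpace_iff P b x).mp hx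
    rw [inLamStar_nfVec_iff] at hlam
    rw [nfVec_eq_zero_iff]
    exact h _ hlam.1 hlam.2

/-! ### Core test: the ambient criterion is `Core P n` (parity split + the symmetric trick) -/

/-- `Core P n` read on ambient vectors: no nonzero vector supported on `n⁺` is killed by `Ŝ` on `n⁺`
(`det Ŝ[n⁺] = 1 ⟺` trivial kernel; PivotAux `det_submatrix_eq_zero_iff`). [folklore] -/
theorem core_iff_forall (P : Position s) (n : Finset (Fin s)) :
    Core P n ↔ ∀ x : V s → ZMod 2, (∀ v, v ∉ plus n → x v = 0) →
      (∀ v ∈ plus n, (P.S *ᵥ x) v = 0) → x = 0 := by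
  unfold Core
  rw [Alt.det_eq_one_iff_det_ne_zero]
  have key := det_submatrix_eq_zero_iff P.S (plus n)
  constructor
  · intro h x hs hk
    by_contra hx
    exact h (key.mpr ⟨x, hx, hs, hk⟩)
  · intro h hdet
    obtain ⟨x, hx, hs, hk⟩ := key.mp hdet
    exact hx (h x hs hk)

/-- **The symmetric trick.** If `x` is supported on `X ∌ ∞` and killed by `Ŝ` on `X`, and `w` is
supported on `X ∪ {∞}`, killed by `Ŝ` there, with `w(∞) = 1`, then `(Ŝ x)(∞) = 0`: indeed
`0 = x·(Ŝ w) = w·(Ŝ x) = w(∞)·(Ŝ x)(∞)` by symmetry of `Ŝ`. [folklore] -/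
theorem mulVec_none_eq_zero_of_witness (P : Position s) {X : Finset (V s)}
    {x w : V s → ZMod 2} (hxs : ∀ v, v ∉ X → x v = 0) (hxk : ∀ v ∈ X, (P.S *ᵥ x) v = 0)
    (hws : ∀ v, v ∉ insert none X → w v = 0) (hwk : ∀ v ∈ insert none X, (P.S *ᵥ w) v = 0)
    (hw : w none = 1) : (P.S *ᵥ x) none = 0 := by
  have h1 : x ⬝ᵥ (P.S *ᵥ w) = 0 := Finset.sum_eq_zero fun v _ => by
    by_cases hv : v ∈ X
    · rw [hwk v (Finset.mem_insert_of_mem hv), mul_zero]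
    · rw [hxs v hv, zero_mul]
  have h2 : x ⬝ᵥ (P.S *ᵥ w) = w ⬝ᵥ (P.S *ᵥ x) := by
    rw [Matrix.dotProduct_mulVec, dotProduct_comm]
    congr 1
    conv_lhs => rw [← P.symm.eq]
    exact Matrix.vecMul_transpose P.S x
  have h3 : w ⬝ᵥ (P.S *ᵥ x) = w none * (P.S *ᵥ x) none := by
    rw [dotProduct, Fintype.sum_option, add_eq_left]
    refine Finset.sum_eq_zero fun l _ => ?_
    by_cases hl : (some l : V s) ∈ X
    · rw [hxk _ hl, mul_zero]
    · rw [hws (some l) (by simp [hl]), zero_mul]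
  rw [h2, h3, hw, one_mul] at h1
  exact h1

/-- A singular principal minor of `Ŝ` on an ODD vertex set has a nonzero kernel vector supported
there (alternating matrices of odd size are singular: `Alt.det_submatrix_eq_zero_of_card_odd`). [folklore] -/
theorem exists_killed_of_card_odd (P : Position s) (Y : Finset (V s)) (hY : Odd Y.card) :
    ∃ x : V s → ZMod 2, x ≠ 0 ∧ (∀ v, v ∉ Y → x v = 0) ∧ ∀ v ∈ Y, (P.S *ᵥ x) v = 0 := by
  apply (det_submatrix_eq_zero_iff P.S Y).mp
  exact Alt.det_submatrix_eq_zero_of_card_odd P.symm P.loopless _ (by rwa [Fintype.card_coe])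

/-- **The core test on ambient vectors**: the `CoreQ` criterion (support in `X = n`, killed on
`X ∪ {∞}`) is equivalent to `Core P n` (`det Ŝ[n⁺] = 1`), by the parity split `n⁺ = n` / `n ∪ {∞}`
and the symmetric trick. [folklore] -/
theorem forall_killed_iff_core (P : Position s) (n : Finset (Fin s)) :
    (∀ y : V s → ZMod 2, (∀ v, v ∉ n.map Function.Embedding.some → y v = 0) →
        (∀ v ∈ insert none (n.map Function.Embedding.some), (P.S *ᵥ y) v = 0) → y = 0) ↔
      Core P n := by
  set X : Finset (V s) := n.map Function.Embedding.some with hX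
  have hnX : (none : V s) ∉ X := by simp [hX]
  have hcard : X.card = n.card := Finset.card_map _
  have hcard' : (insert none X).card = n.card + 1 := by rw [Finset.card_insert_of_notMem hnX, hcard]
  -- support inside `X ∪ {∞}` plus `w ∞ = 0` means support inside `X`
  have hsupp : ∀ w : V s → ZMod 2, (∀ v, v ∉ insert none X → w v = 0) → w none = 0 →
      ∀ v, v ∉ X → w v = 0 := by
    intro w hws hwn v hv
    by_cases hvn : v = none
    · rw [hvn, hwn]
    · exact hws v (by simp [hvn, hv])
  rw [core_iff_forall]
  by_cases hev : Even n.card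
  · have hplus : plus n = X := by rw [plus, if_pos hev]
    rw [hplus]
    constructor
    · intro hKQ x hxs hxk
      -- the odd set `X ∪ {∞}` carries a kernel vector `w`
      obtain ⟨w, hw0, hws, hwk⟩ := exists_killed_of_card_odd P (insert none X)
        (by rw [hcard']; exact hev.add_one)
      by_cases hwn : w none = 0
      · exact absurd (hKQ w (hsupp w hws hwn) hwk) hw0
      · have hw1 : w none = 1 := (Alt.eq_one_iff_ne_zero _).mpr hwn
        refine hKQ x hxs fun v hv => ?_
        rcases Finset.mem_insert.mp hv with rfl | hv
        · exact mulVec_none_eq_zero_of_witness P hxs hxk hws hwk hw1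
        · exact hxk v hv
    · intro hK y hys hyk
      exact hK y hys fun v hv => hyk v (Finset.mem_insert_of_mem hv)
  · have hodd : Odd n.card := Nat.not_even_iff_odd.mp hev
    have hplus : plus n = insert none X := by rw [plus, if_neg hev]
    rw [hplus]
    constructor
    · intro hKQ w hws hwk
      by_cases hwn : w none = 0
      · exact hKQ w (hsupp w hws hwn) hwk
      · exfalso
        have hw1 : w none = 1 := (Alt.eq_one_iff_ne_zero _).mpr hwn
        -- the odd set `X` carries a kernel vector `x`; the trick upgrades it to `X ∪ {∞}`
        obtain ⟨x, hx0, hxs, hxk⟩ :=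
          exists_killed_of_card_odd P X (by rw [hcard]; exact Nat.not_even_iff_odd.mp hev)
        refine hx0 (hKQ x hxs fun v hv => ?_)
        rcases Finset.mem_insert.mp hv with rfl | hv
        · exact mulVec_none_eq_zero_of_witness P hxs hxk hws hwk hw1
        · exact hxk v hv
    · intro hK y hys hyk
      exact hK y (fun v hv => hys v fun h => hv (Finset.mem_insert_of_mem h)) hyk

/-- **QS1c, second half**: `n` is core for the Lagrangian `𝒰(P, b)` iff `det Ŝ[n⁺] = 1` (Mazur–Rubin's
core vertices `H¹_{𝓕(n)*} = 0` read in T3 normal form). [cite: MazurRubin2004Intro, Def. 4.2] -/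
theorem coreQ_nfSpace_iff_core (P : Position s) (b : Bool) (n : Finset (Fin s)) :
    CoreQ (nfSpace P b) n ↔ Core P n :=
  (coreQ_nfSpace_iff P b n).trans (forall_killed_iff_core P n)

/-- **QS1c `CoreTest` (lens-2 GEN 10, T3 (i))**: in T3 normal form `𝒰(P, b)` is a totally singular
Lagrangian, and `n` is core iff `Core P n` (`det Ŝ[n⁺] = 1`, odd number of perfect matchings of
`Γ̂[n⁺]`). (lens-2 G5.2 T3 (i); exec 1 024 / 1 024 core tests at |D| = 3.) [cite: MazurRubin2004Intro, Def. 4.2] -/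
theorem coreTest_holds : CoreTest := fun _ P b =>
  ⟨isTSLagrangian_nfSpace P b, fun n => coreQ_nfSpace_iff_core P b n⟩

end Summit.BirchSwinnertonDyer.Rank1Residual.X5.SelmerSolitaire.Quadratic
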